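import Summits.CriticalPhenomena.PercolationContinuityZ3.Theorems.SahiMasterFamilyGHConverse

/-!
# PC-k and (GH)_k are MONOTONE in `k`: the orders where they hold form an initial segment

Unit `prim-masterthm-p4` (gen 16; crux anchor stmt-CriticalPhenomena-4575, helper work; memo
`run/shared/lean/prim/prim-masterthm/prim-masterthm-p4/P4-GEN16-REPORT.md` §2).  Companion of `…GHBridge` / `…GHConverse` (`PCNonneg k`,
`gSystemNonneg_iff_pcNonneg`).  Sahi's branching identity `E_{n+2}(f_0,…,f_n,1) = n·E_{n+1}(f_0,…,f_n)` [Sahi2008, Thm. 6] (tree: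
`sahiE_snoc_one`) applied to a principal-cap family padded with the sure event:
* `pcNonneg_anti : PCNonneg (n+2) → PCNonneg (n+1)`, `pcNonneg_of_le : 1 ≤ k → k ≤ k' → PCNonneg k' → PCNonneg k`, `pcNonneg_one`;
* `gSystemNonneg_anti`, `gSystemNonneg_of_le` (through the kernel equivalence `(GH) ⟺ PC`).
So a refutation of PC-k (equivalently of (GH)_k) at some order refutes it at every larger order, and a proof at order `k` proves all smaller orders.
HONEST FRAMING: monotonicity only; PC-k / (GH)_k OPEN for k ≥ 8; Sahi's `C_k` and the master theorem OPEN.  Axioms standard. [this work]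
-/

noncomputable section

open scoped Classical

namespace Summit.CriticalPhenomena.PercolationContinuityZ3.Theorems

namespace GHBridge

open Finset
open Literature.Combinatorics.Sahi2008
open Literature.Probability.Percolation.DecisionTree (ind ind_of_mem ind_nonneg)

/-- PC-1 holds: `E_1(1_U) = μ_p(U) ≥ 0`. [this work] -/
theorem pcNonneg_one : PCNonneg 1 := by
  intro ι _ p U _ _ _
  rw [sahiE_one_apply]
  exact ex_nonneg (fun ω => (isFKGMeasure_bernoulliWeight p).nonneg ω) fun ω => ind_nonneg _ ω

/-- **Downward step**: PC-(n+2) ⇒ PC-(n+1) (pad the family with the sure event; Sahi's branching identity). [this work] -/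
theorem pcNonneg_anti {n : ℕ} (h : PCNonneg (n + 2)) : PCNonneg (n + 1) := by
  rcases Nat.eq_zero_or_pos n with hn | hn
  · subst hn; exact pcNonneg_one
  intro ι _ p U hU c hpc
  -- the padded family `U' = (U_0,…,U_n, univ)` is principal-cap with the same cores
  have hU' : ∀ j, IsUpperSet ((Fin.snoc U (Set.univ : Set (Set ι)) : Fin (n + 2) → Set (Set ι)) j) := by
    intro j
    refine Fin.lastCases ?_ (fun i => ?_) j
    · rw [Fin.snoc_last]; exact isUpperSet_univ
    · rw [Fin.snoc_castSucc]; exact hU i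
  have hpc' : ∀ T : Set ι, (∀ j, T ∈ (Fin.snoc U (Set.univ : Set (Set ι)) : Fin (n + 2) → Set (Set ι)) j) ↔ (↑c : Set ι) ⊆ T := by
    intro T
    rw [← hpc T]
    constructor
    · intro hT j
      have := hT (Fin.castSucc j)
      rwa [Fin.snoc_castSucc] at this
    · intro hT j
      refine Fin.lastCases ?_ (fun i => ?_) j
      · rw [Fin.snoc_last]; exact Set.mem_univ _
      · rw [Fin.snoc_castSucc]; exact hT i
  have key := h ι p (Fin.snoc U (Set.univ : Set (Set ι))) hU' c hpc'
  have hfun : (fun j => ind ((Fin.snoc U (Set.univ : Set (Set ι)) : Fin (n + 2) → Set (Set ι)) j)) =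
      (Fin.snoc (fun j => ind (U j)) 1 : Fin (n + 2) → Set ι → ℝ) := by
    funext j
    refine Fin.lastCases ?_ (fun i => ?_) j
    · rw [Fin.snoc_last, Fin.snoc_last, ind_univ_eq_one]
    · rw [Fin.snoc_castSucc, Fin.snoc_castSucc]
  rw [hfun, sahiE_snoc_one (isFKGMeasure_bernoulliWeight p).sum_eq_one] at key
  have hn' : (0 : ℝ) < (n : ℝ) := by exact_mod_cast hn
  exact (mul_nonneg_iff_of_pos_left hn').1 key

/-- **PC-k is monotone**: PC-k' ⇒ PC-k for `1 ≤ k ≤ k'`. [this work] -/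
theorem pcNonneg_of_le {k k' : ℕ} (hk : 1 ≤ k) (hkk' : k ≤ k') (h : PCNonneg k') : PCNonneg k := by
  induction k' with
  | zero => omega
  | succ m ih =>
    rcases Nat.eq_or_lt_of_le hkk' with heq | hlt
    · rw [heq]; exact h
    · have hm : 1 ≤ m := by omega
      obtain ⟨m', rfl⟩ : ∃ m', m = m' + 1 := ⟨m - 1, by omega⟩
      exact ih (by omega) (pcNonneg_anti h)

/-- **(GH)_k is monotone** (downward step), through `(GH) ⟺ PC`. [this work] -/
theorem gSystemNonneg_anti {n : ℕ} (h : GHConjecture.GSystemNonneg (n + 2)) : GHConjecture.GSystemNonneg (n + 1) :=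
  gSystemNonneg_of_pcNonneg (pcNonneg_anti (pcNonneg_of_gSystemNonneg h))

/-- (GH)_{k'} ⇒ (GH)_k for `1 ≤ k ≤ k'`. [this work] -/
theorem gSystemNonneg_of_le {k k' : ℕ} (hk : 1 ≤ k) (hkk' : k ≤ k') (h : GHConjecture.GSystemNonneg k') :
    GHConjecture.GSystemNonneg k := by
  obtain ⟨j, rfl⟩ : ∃ j, k = j + 1 := ⟨k - 1, by omega⟩
  exact gSystemNonneg_of_pcNonneg (pcNonneg_of_le hk hkk' (pcNonneg_of_gSystemNonneg h))

end GHBridge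

end Summit.CriticalPhenomena.PercolationContinuityZ3.Theorems
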